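import Mathlib.NumberTheory.NumberField.ClassNumber
import Mathlib.RingTheory.DedekindDomain.Ideal.Lemmas
import Mathlib.RingTheory.Ideal.Norm.AbsNorm
import Literature.NumberTheory.Automorphic.BrandtModuleDictionary
import HarnessLib

/-!
# Gross points of a quaternion order, the `Pic(𝓞_K)`-action, and toric periods

Definition item `defn-Brandt.toricPeriod` (topic `NumberTheory/Automorphic`), requested by route
`BirchSwinnertonDyer/ToricShedding` (items `ToricShedding`, `BipartiteStructure`, which inline the
notion) and useful to `ABC/QuaternionicDegree`.  Everything is phrased in the vocabulary of
`BrandtXi.lean` (`Brandt.leftOrder`, `Brandt.rightOrder`, `Brandt.rightIdeals`,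
`Brandt.rightClassSetoid`, `Brandt.ClassSet`, `Brandt.XiSetup`): right ideals `I` of an order `O`,
classes `[I] = [α I]` (`α ∈ Dˣ`), left orders `O_L(I)`.

Let `D` be a `ℚ`-algebra (a definite quaternion algebra `S.D` of a Brandt set-up
`S : Brandt.XiSetup N⁺ N⁻` in the applications), `O ⊆ D` a `ℤ`-order (`S.O`), `K` a number field
(imaginary quadratic in the applications) and `ψ : K →ₐ[ℚ] D` an embedding.

* `Brandt.IsGrossPoint O ψ I` — **Gross point (special point, CM point) of conductor `1`**: `I` is
  an invertible right `O`-ideal (`I ∈ rightIdeals O`) and `ψ` embeds `𝓞_K` *optimally* into the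
  left order of `I`: `ψ(𝓞_K) ⊆ O_L(I)` and `ψ(K) ∩ O_L(I) = ψ(𝓞_K)`.  These are Gross's special
  points `(f : 𝓞 → R_i)` of *Heights and the special values of L-series* §3 (there with left
  ideals `I_i` and their right orders `R_i`; the tree's Brandt files use Voight's mirror convention),
  the "definite Heegner points" `(f, R)` of Bertolini–Darmon, and the CM points of conductor `1` and
  level `R̂ˣ` of Vatsal's survey (§6.1, Remark 6.3: for `F = ℚ` the adelic and the `(f, R)`
  descriptions agree).
* `Brandt.imageLattice ψ J = ℤ⟨ψ(J)⟩` and `Brandt.grossTranslate ψ J I = ψ(J) I` — the translate of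
  `I` by an ideal `J ⊆ 𝓞_K` along `ψ`.  **The ideal group of `K` acts on Gross points** by
  `J · (ψ, I) = (ψ, ψ(J) I)`: `IsGrossPoint.translate` (for `J ≠ 0`, `ψ(J) I` is again an invertible
  right `O`-ideal — inverse `I' ψ(J⁻¹)`, left order `ψ(J) O_L(I) ψ(J⁻¹)` — optimally containing
  `ψ(𝓞_K)`), and ideals in the same class give translates in the same right class
  (`exists_grossTranslate_eq_smul`: `ψ(xJ) I = ψ(x) · ψ(J) I`), so the action descends to
  **`Pic(𝓞_K) = Cl(K)` acting on classes**: `IsGrossPoint.act h : ClassGroup (𝓞 K) → ClassSet O`,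
  `[𝔞] ↦ [ψ(𝔞) I]` (computed on the integral representative `Brandt.idealRep 𝔞`, independent of it
  by `IsGrossPoint.act_eq_mk`; in the requester's unbundled form `IsGrossPoint.exists_rep_act`).
  This is the free action of `Pic(𝓞_K)` on special points of Gross §3 / Vatsal §7.1, (7-5).
* `Brandt.toricPeriod O ψ I φ = Σ_{[𝔞] ∈ Cl(K)} φ([ψ(𝔞) I])` for `φ : ClassSet O → R`, `R` any
  additive commutative monoid — the **toric period** (Gross's period `Σ_σ φ(P^σ)` of the CM divisor
  `Σ_{σ ∈ Pic(𝓞_K)} P^σ`, Vatsal (7-5) with trivial character; by Gross's formula / Waldspurger,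
  Vatsal Thm. 6.4, its non-vanishing for a Hecke eigenvector `φ` detects `L(f/K, 1) ≠ 0`).  Defined
  for every `(ψ, I)` through `Brandt.evalAtLattice` (value `0` at lattices that are not invertible
  right `O`-ideals); for a Gross point it is the honest sum over the orbit,
  `IsGrossPoint.toricPeriod_eq : toricPeriod O ψ I φ = Σ_𝔞 φ (h.act 𝔞)`.

## Design

* Generality: any ring `D` with `Algebra ℚ D`, any `O : Submodule ℤ D`, any number field `K`; for a
  set-up `S` one writes `Brandt.IsGrossPoint S.O ψ I`, `Brandt.toricPeriod S.O ψ I φ`.  Higher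
  conductors (`ψ(K) ∩ O_L(I) = ψ(𝓞_c)`) are not needed by the requesters and not defined.
* The lattice `ψ(M)` of an `𝓞_K`-submodule `M ⊆ K` is `Brandt.embLattice ψ M`
  (`Submodule.map` of `M` viewed over `ℤ`); it is multiplicative (`embLattice_mul`, from
  `Submodule.map_mul`), which drives all proofs (`ψ(J) ψ(J⁻¹) = ψ(𝓞_K) ∋ 1`).  The user-facing
  `imageLattice ψ J` is the literal `ℤ`-span of `ψ '' J` used by the route items
  (`imageLattice_eq_embLattice`).
* No facts are introduced; all statements are proved.

## What is NOT here

Transitivity/freeness of the action on Gross points of given conductor (Gross §3), the count of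
optimal embeddings (Eichler), Gross's special value formula, and the bipartite-Euler-system
structure theorem of C.-H. Kim (Trans. AMS 2024, Thm. 5.23; source not held — acquisition request
`acq-06247`), which the requester wants as a named fact once the printed statement is available.

## References

* B. H. Gross, *Heights and the special values of L-series*, CMS Conf. Proc. 7 (1987), §3
  [Gross1987].
* V. Vatsal, *Special value formulae for Rankin L-functions*, in: Heegner points and Rankin
  L-series, MSRI Publ. 49 (2004), §6.1, Remark 6.3, Theorem 6.4, §7.1 and (7-5) [Vatsal2004].
* M. Bertolini, H. Darmon, *Heegner points on Mumford–Tate curves*, Invent. Math. 126 (1996)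
  [BertoliniDarmon1996].
* J. Voight, *Quaternion Algebras*, GTM 288 (2021), Def. 16.5.1, 17.3.1, §30.3 (optimal
  embeddings) [Voight2021].
-/

noncomputable section

open scoped Pointwise nonZeroDivisors NumberField
open NumberField IsLocalization

universe u

namespace Literature.NumberTheory.Automorphic

namespace Brandt

/-! ### Integral representatives of ideal classes -/

section ClassGroup

variable {R : Type*} [CommRing R] [IsDedekindDomain R]

/-- A non-zero integral ideal representing the class `𝔞 ∈ Cl(R)` (every class contains an integral
ideal, `ClassGroup.mk0_surjective`; the representative is chosen once and for all by
`Classical.choose`). [folklore] -/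
def idealRep (𝔞 : ClassGroup R) : (Ideal R)⁰ :=
  Classical.choose (ClassGroup.mk0_surjective 𝔞)

/-- The chosen representative represents: `[idealRep 𝔞] = 𝔞`. [folklore] -/
@[simp] theorem mk0_idealRep (𝔞 : ClassGroup R) : ClassGroup.mk0 (idealRep 𝔞) = 𝔞 :=
  Classical.choose_spec (ClassGroup.mk0_surjective 𝔞)

/-- Elements of `(Ideal R)⁰` are non-zero ideals. [folklore] -/
theorem ne_bot_of_mem_nonZeroDivisors (J : (Ideal R)⁰) : (J : Ideal R) ≠ ⊥ := fun h =>
  nonZeroDivisors.coe_ne_zero J (by rw [h, Submodule.zero_eq_bot])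

end ClassGroup

/-! ### Lattices in `D` coming from `K` along an embedding `ψ : K → D` -/

section Lattices

variable {D : Type u} [Ring D] [Algebra ℚ D]
variable {K : Type*} [Field K] [NumberField K]

/-- The **image lattice** `ψ(M) ⊆ D` of an `𝓞_K`-submodule `M ⊆ K` (a fractional ideal, say) under
an embedding `ψ : K →ₐ[ℚ] D`: the `ℤ`-submodule `{ψ(y) : y ∈ M}`. [folklore] -/
def embLattice (ψ : K →ₐ[ℚ] D) (M : Submodule (𝓞 K) K) : Submodule ℤ D :=
  (M.restrictScalars ℤ).map (ψ.toRingHom.toIntAlgHom).toLinearMap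

/-- `x ∈ ψ(M) ↔ x = ψ(y)` for some `y ∈ M`. [folklore] -/
theorem mem_embLattice_iff {ψ : K →ₐ[ℚ] D} {M : Submodule (𝓞 K) K} {x : D} :
    x ∈ embLattice ψ M ↔ ∃ y ∈ M, ψ y = x := by
  simp [embLattice]

/-- `ψ(y) ∈ ψ(M)` for `y ∈ M`. [folklore] -/
theorem map_mem_embLattice {ψ : K →ₐ[ℚ] D} {M : Submodule (𝓞 K) K} {y : K} (hy : y ∈ M) :
    ψ y ∈ embLattice ψ M :=
  mem_embLattice_iff.mpr ⟨y, hy, rfl⟩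

/-- **`ψ(M N) = ψ(M) ψ(N)`**: the image lattice is multiplicative (`ψ` is a ring homomorphism;
`Submodule.map_mul`). [folklore] -/
theorem embLattice_mul (ψ : K →ₐ[ℚ] D) (M N : Submodule (𝓞 K) K) :
    embLattice ψ (M * N) = embLattice ψ M * embLattice ψ N := by
  rw [embLattice, Submodule.restrictScalars_mul, Submodule.map_mul]; rfl

/-- `1 ∈ ψ(𝓞_K)`. [folklore] -/
theorem one_mem_embLattice_one (ψ : K →ₐ[ℚ] D) : (1 : D) ∈ embLattice ψ 1 :=
  mem_embLattice_iff.mpr ⟨1, Submodule.one_le.mp le_rfl, map_one ψ⟩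

/-- Elements of an image lattice commute with `ψ(K)` (`K` is commutative). [folklore] -/
theorem map_mul_comm_of_mem_embLattice {ψ : K →ₐ[ℚ] D} {M : Submodule (𝓞 K) K} {b : D}
    (hb : b ∈ embLattice ψ M) (k : K) : ψ k * b = b * ψ k := by
  obtain ⟨y, -, rfl⟩ := mem_embLattice_iff.mp hb
  rw [← map_mul, ← map_mul, mul_comm]

/-- The image lattice of a fractional ideal is finitely generated (fractional ideals of the
Noetherian ring `𝓞_K` are finitely generated, and `𝓞_K` is finite over `ℤ`). [folklore] -/
theorem fg_embLattice (ψ : K →ₐ[ℚ] D) (J : FractionalIdeal (𝓞 K)⁰ K) :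
    (embLattice ψ (J : Submodule (𝓞 K) K)).FG :=
  (FractionalIdeal.fg_of_isNoetherianRing le_rfl J).restrictScalars.map _

/-- `ψ(𝓞_K c) = ψ(c) ψ(𝓞_K)` for `c ∈ K`. [folklore] -/
theorem embLattice_span_singleton (ψ : K →ₐ[ℚ] D) (c : K) :
    embLattice ψ (Submodule.span (𝓞 K) {c}) = Submodule.span ℤ {ψ c} * embLattice ψ 1 := by
  rw [Submodule.span_singleton_mul]
  ext z
  constructor
  · intro hz
    obtain ⟨y, hy, rfl⟩ := mem_embLattice_iff.mp hz
    obtain ⟨r, rfl⟩ := Submodule.mem_span_singleton.mp hy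
    refine (Submodule.mem_smul_pointwise_iff_exists _ _ _).mpr
      ⟨ψ r, map_mem_embLattice (Submodule.mem_one.mpr ⟨r, rfl⟩), ?_⟩
    rw [smul_eq_mul, ← map_mul, Algebra.smul_def, mul_comm]
  · intro hz
    obtain ⟨m, hm, rfl⟩ := (Submodule.mem_smul_pointwise_iff_exists _ _ _).mp hz
    obtain ⟨y, hy, rfl⟩ := mem_embLattice_iff.mp hm
    obtain ⟨r, rfl⟩ := Submodule.mem_one.mp hy
    refine mem_embLattice_iff.mpr ⟨r • c, Submodule.mem_span_singleton.mpr ⟨r, rfl⟩, ?_⟩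
    rw [Algebra.smul_def, mul_comm, map_mul, smul_eq_mul]

/-- **`ψ(J)`** for an ideal `J ⊆ 𝓞_K`: the `ℤ`-span in `D` of the image of `J` under `ψ` (the
lattice `f(𝔞)` of Gross 1987 §3; equal to `embLattice ψ J`, `imageLattice_eq_embLattice` — the image
is already a subgroup). [cite: Gross1987, §3] -/
def imageLattice (ψ : K →ₐ[ℚ] D) (J : Ideal (𝓞 K)) : Submodule ℤ D :=
  Submodule.span ℤ ((fun x : 𝓞 K => ψ (x : K)) '' (J : Set (𝓞 K)))

/-- `imageLattice ψ J` is the image lattice of `J` viewed inside `K`. [folklore] -/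
theorem imageLattice_eq_embLattice (ψ : K →ₐ[ℚ] D) (J : Ideal (𝓞 K)) :
    imageLattice ψ J = embLattice ψ (coeSubmodule K J) := by
  refine le_antisymm (Submodule.span_le.mpr ?_) fun x hx => ?_
  · rintro _ ⟨j, hj, rfl⟩
    exact map_mem_embLattice ((mem_coeSubmodule K J).mpr ⟨j, hj, rfl⟩)
  · obtain ⟨y, hy, rfl⟩ := mem_embLattice_iff.mp hx
    obtain ⟨j, hj, rfl⟩ := (mem_coeSubmodule K J).mp hy
    exact Submodule.subset_span ⟨j, hj, rfl⟩

/-- `imageLattice ψ J` is the image lattice of the fractional ideal `J`. [folklore] -/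
theorem imageLattice_eq_embLattice_coeIdeal (ψ : K →ₐ[ℚ] D) (J : Ideal (𝓞 K)) :
    imageLattice ψ J = embLattice ψ ((J : FractionalIdeal (𝓞 K)⁰ K) : Submodule (𝓞 K) K) := by
  rw [imageLattice_eq_embLattice, FractionalIdeal.coe_coeIdeal]

/-- **Gross's translate `ψ(J) I`** of a lattice `I ⊆ D` by an ideal `J ⊆ 𝓞_K` along `ψ`: the
action `J · (ψ, I) = (ψ, ψ(J) I)` of the ideal group of `K` on pairs (embedding, right ideal)
(Gross 1987 §3, with left and right exchanged as in all Brandt files of the tree; Vatsal 2004 §6.1: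
the action of `T̂ / T(ℚ) ⊇ Pic(𝓞_K)` on CM points). [cite: Gross1987, §3] -/
def grossTranslate (ψ : K →ₐ[ℚ] D) (J : Ideal (𝓞 K)) (I : Submodule ℤ D) : Submodule ℤ D :=
  imageLattice ψ J * I

/-- `grossTranslate` unfolded to the form inlined by route `ToricShedding`. [folklore] -/
theorem grossTranslate_def (ψ : K →ₐ[ℚ] D) (J : Ideal (𝓞 K)) (I : Submodule ℤ D) :
    grossTranslate ψ J I =
      Submodule.span ℤ ((fun x : 𝓞 K => ψ (x : K)) '' (J : Set (𝓞 K))) * I :=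
  rfl

/-- **`ψ(x J) I = ψ(x) · ψ(J) I`**: translating by a principal multiple of `J` changes the translate
by left multiplication by the unit `ψ(x)` — the action descends to ideal classes. [folklore] -/
theorem grossTranslate_span_singleton_mul (ψ : K →ₐ[ℚ] D) (x : 𝓞 K) (J : Ideal (𝓞 K))
    (I : Submodule ℤ D) :
    grossTranslate ψ (Ideal.span {x} * J) I = (ψ (x : K)) • grossTranslate ψ J I := by
  rw [grossTranslate, grossTranslate, imageLattice_eq_embLattice, imageLattice_eq_embLattice,
    coeSubmodule_mul, embLattice_mul, coeSubmodule_span_singleton, embLattice_span_singleton,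
    mul_assoc (Submodule.span ℤ _), ← embLattice_mul, one_mul, mul_assoc,
    Submodule.span_singleton_mul]

/-- **Ideals in the same class give translates in the same right class**: if `[J₁] = [J₂]` in
`Cl(K)` then `ψ(J₂) I = α ψ(J₁) I` for a unit `α ∈ ψ(Kˣ) ⊆ Dˣ`. [folklore] -/
theorem exists_grossTranslate_eq_smul {J₁ J₂ : (Ideal (𝓞 K))⁰}
    (hJ : ClassGroup.mk0 J₁ = ClassGroup.mk0 J₂) (ψ : K →ₐ[ℚ] D) (I : Submodule ℤ D) :
    ∃ α : Dˣ, grossTranslate ψ J₂ I = α • grossTranslate ψ J₁ I := by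
  obtain ⟨x, y, hx, hy, hxy⟩ := ClassGroup.mk0_eq_mk0_iff.mp hJ
  have hx' : (x : K) ≠ 0 := RingOfIntegers.coe_ne_zero_iff.mpr hx
  have hy' : (y : K) ≠ 0 := RingOfIntegers.coe_ne_zero_iff.mpr hy
  set ux : Dˣ := Units.map (ψ : K →* D) (Units.mk0 (x : K) hx') with hux
  set uy : Dˣ := Units.map (ψ : K →* D) (Units.mk0 (y : K) hy') with huy
  have key : (ψ (x : K)) • grossTranslate ψ J₁ I = (ψ (y : K)) • grossTranslate ψ J₂ I := by
    rw [← grossTranslate_span_singleton_mul, ← grossTranslate_span_singleton_mul, hxy]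
  refine ⟨uy⁻¹ * ux, ?_⟩
  rw [mul_smul, units_smul_submodule_eq ux, show ((ux : Dˣ) : D) = ψ (x : K) from rfl, key,
    show (ψ (y : K)) = ((uy : Dˣ) : D) from rfl, ← units_smul_submodule_eq uy, inv_smul_smul]

end Lattices

/-! ### Gross points -/

section GrossPoints

variable {D : Type u} [Ring D] [Algebra ℚ D]
variable {K : Type*} [Field K] [NumberField K]

/-- A **Gross point of conductor `1`** on the order `O ⊆ D` for the field `K`: a pair `(ψ, I)` of an
embedding `ψ : K →ₐ[ℚ] D` and an invertible right `O`-ideal `I` (`I ∈ rightIdeals O`) such that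
`ψ` restricts to an **optimal embedding of the maximal order** `𝓞_K` into the left order of `I`:
`ψ(𝓞_K) ⊆ O_L(I)` and `ψ(K) ∩ O_L(I) = ψ(𝓞_K)` (Gross 1987 §3, special points `(f, R_i)` with
`f : 𝓞 → R_i` optimal; Bertolini–Darmon 1996, definite Heegner points `(f, R)`; Vatsal 2004 §6.1
and Remark 6.3, CM points of conductor `1`; optimal embeddings: Voight §30.3).  Points are taken up
to `(ψ, I) ∼ (ψ, α I)`, `α ∈ Dˣ`, through `Brandt.ClassSet O`. [cite: Vatsal2004, §6.1 and Remark 6.3] -/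
structure IsGrossPoint (O : Submodule ℤ D) (ψ : K →ₐ[ℚ] D) (I : Submodule ℤ D) : Prop where
  /-- `I` is an invertible right fractional `O`-ideal with right order `O`. -/
  mem_rightIdeals : I ∈ rightIdeals O
  /-- `ψ(𝓞_K) ⊆ O_L(I)`. -/
  map_mem_leftOrder : ∀ x : 𝓞 K, ψ (x : K) ∈ leftOrder I
  /-- Optimality: `ψ⁻¹(O_L(I)) ⊆ 𝓞_K`. -/
  mem_range_of_map_mem_leftOrder : ∀ x : K, ψ x ∈ leftOrder I → x ∈ (algebraMap (𝓞 K) K).range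

/-- `IsGrossPoint` as the conjunction inlined by route `ToricShedding`. [folklore] -/
theorem isGrossPoint_iff {O : Submodule ℤ D} {ψ : K →ₐ[ℚ] D} {I : Submodule ℤ D} :
    IsGrossPoint O ψ I ↔ I ∈ rightIdeals O ∧ (∀ x : 𝓞 K, ψ (x : K) ∈ leftOrder I) ∧
      (∀ x : K, ψ x ∈ leftOrder I → x ∈ (algebraMap (𝓞 K) K).range) :=
  ⟨fun h => ⟨h.1, h.2, h.3⟩, fun h => ⟨h.1, h.2.1, h.2.2⟩⟩

variable {O I : Submodule ℤ D} {ψ : K →ₐ[ℚ] D}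

/-- For a Gross point, `ψ(𝓞_K) ⊆ O_L(I)` as lattices. [folklore] -/
theorem IsGrossPoint.embLattice_one_le (h : IsGrossPoint O ψ I) : embLattice ψ 1 ≤ leftOrder I := by
  intro x hx
  obtain ⟨y, hy, rfl⟩ := mem_embLattice_iff.mp hx
  obtain ⟨z, rfl⟩ := Submodule.mem_one.mp hy
  exact h.map_mem_leftOrder z

/-- **The ideal group acts on Gross points**: for a Gross point `(ψ, I)` and a non-zero ideal
`J ⊆ 𝓞_K`, `(ψ, ψ(J) I)` is again a Gross point — `ψ(J) I` is a full lattice with right order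
`O_R(I) = O`, it is invertible with inverse `I' ψ(J⁻¹)` (`I'` the inverse of `I`) and left order
`ψ(J) O_L(I) ψ(J⁻¹)`, which contains `ψ(𝓞_K)` optimally (Gross 1987 §3: `Pic(𝒪)` permutes the
special points; Vatsal 2004 §6.1). The computation only uses `ψ(J) ψ(J⁻¹) = ψ(J⁻¹) ψ(J) = ψ(𝓞_K)`,
`1 ∈ ψ(𝓞_K) ⊆ O_L(I)` and that `ψ(K)` is commutative. [cite: Vatsal2004, §6.1] -/
theorem IsGrossPoint.translate (h : IsGrossPoint O ψ I) {J : Ideal (𝓞 K)} (hJ : J ≠ ⊥) :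
    IsGrossPoint O ψ (grossTranslate ψ J I) := by
  have hEΛ : embLattice ψ 1 ≤ leftOrder I := h.embLattice_one_le
  obtain ⟨⟨hIfull, hIright, I', hI'full, hII', hΛR, hI'I, hLI'⟩, hemb, hopt⟩ := h
  set Jf : FractionalIdeal (𝓞 K)⁰ K := ((J : Ideal (𝓞 K)) : FractionalIdeal (𝓞 K)⁰ K) with hJfdef
  have hJf : Jf ≠ 0 := FractionalIdeal.coeIdeal_ne_zero.mpr hJ
  set A := embLattice ψ (Jf : Submodule (𝓞 K) K) with hA
  set B := embLattice ψ ((Jf⁻¹ : FractionalIdeal (𝓞 K)⁰ K) : Submodule (𝓞 K) K) with hB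
  set E := embLattice ψ (1 : Submodule (𝓞 K) K) with hE
  set Λ := leftOrder I with hΛ
  have hX : grossTranslate ψ J I = A * I := by
    rw [grossTranslate, imageLattice_eq_embLattice_coeIdeal]
  rw [hX]
  -- the basic identities
  have hAB : A * B = E := by
    rw [hA, hB, ← embLattice_mul, ← FractionalIdeal.coe_mul, mul_inv_cancel₀ hJf,
      FractionalIdeal.coe_one]
  have hBA : B * A = E := by
    rw [hA, hB, ← embLattice_mul, ← FractionalIdeal.coe_mul, inv_mul_cancel₀ hJf,
      FractionalIdeal.coe_one]
  have h1E : (1 : D) ∈ E := one_mem_embLattice_one ψ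
  have h1Λ : (1 : D) ∈ Λ := one_mem_leftOrder I
  have hEI : E * I = I := by
    refine le_antisymm (Submodule.mul_le.mpr fun e he m hm => hEΛ he m hm) fun m hm => ?_
    rw [← one_mul m]
    exact Submodule.mul_mem_mul h1E hm
  have hEΛ' : E * Λ = Λ := by
    refine le_antisymm (Submodule.mul_le.mpr fun e he l hl => mul_mem_leftOrder (hEΛ he) hl)
      fun l hl => ?_
    rw [← one_mul l]
    exact Submodule.mul_mem_mul h1E hl
  have hΛE : Λ * E = Λ := by
    refine le_antisymm (Submodule.mul_le.mpr fun l hl e he => mul_mem_leftOrder hl (hEΛ he))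
      fun l hl => ?_
    rw [← mul_one l]
    exact Submodule.mul_mem_mul hl h1E
  have hΛI : Λ * I = I := Brandt.leftOrder_mul_self I
  have hOI' : rightOrder I * I' = I' := by rw [← hLI']; exact Brandt.leftOrder_mul_self I'
  have hI'Λ : I' * Λ = I' := by rw [hΛR]; exact Brandt.mul_rightOrder_self I'
  have hAle : A ≤ A * Λ := fun a ha => by
    rw [← mul_one a]
    exact Submodule.mul_mem_mul ha h1Λ
  -- the translate `X`, its inverse `X'` and its left order `Λ'`
  set X := A * I with hXdef
  set X' := I' * B with hX'def
  set Λ' := A * Λ * B with hΛ'def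
  have hXX' : X * X' = Λ' := by
    rw [hXdef, hX'def, hΛ'def, ← mul_assoc, mul_assoc A I I', hII']
  have hBX : B * X = I := by rw [hXdef, ← mul_assoc, hBA, hEI]
  have hX'X : X' * X = rightOrder I := by
    rw [hX'def, hXdef, ← mul_assoc, mul_assoc I' B A, hBA, mul_assoc, hEI, hI'I]
  have hΛ'X : Λ' * X = X := by
    rw [hΛ'def, hXdef, ← mul_assoc, mul_assoc (A * Λ) B A, hBA, mul_assoc A Λ E, hΛE, mul_assoc,
      hΛI]
  have hX'Λ' : X' * Λ' = X' := by
    rw [hX'def, hΛ'def, ← mul_assoc, ← mul_assoc, mul_assoc I' B A, hBA, mul_assoc I' E Λ, hEΛ',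
      hI'Λ]
  have hEΛ'le : E ≤ Λ' := by
    rw [← hAB, hΛ'def]
    exact mul_le_mul' hAle le_rfl
  have h1Λ' : (1 : D) ∈ Λ' := hEΛ'le h1E
  have hBΛ'A : B * Λ' * A = Λ := by
    rw [hΛ'def, ← mul_assoc B (A * Λ) B, ← mul_assoc B A Λ, hBA, hEΛ', mul_assoc, hBA, hΛE]
  -- the orders of `X` and `X'`
  have hLX : leftOrder X = Λ' := by
    refine le_antisymm (fun x hx => ?_) fun x hx m hm => ?_
    · have hx' : x ∈ leftOrder (X * X') := Brandt.leftOrder_le_leftOrder_mul X X' hx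
      rw [hXX'] at hx'
      simpa using hx' 1 h1Λ'
    · have : x * m ∈ Λ' * X := Submodule.mul_mem_mul hx hm
      rwa [hΛ'X] at this
  have hRX : rightOrder X = rightOrder I := by
    refine le_antisymm (fun x hx => ?_) (Brandt.rightOrder_le_rightOrder_mul A I)
    have hx' : x ∈ rightOrder (B * X) := Brandt.rightOrder_le_rightOrder_mul B X hx
    rwa [hBX] at hx'
  have hRX' : rightOrder X' = Λ' := by
    refine le_antisymm (fun x hx => ?_) fun x hx m hm => ?_
    · have hx' : x ∈ rightOrder (X * X') := Brandt.rightOrder_le_rightOrder_mul X X' hx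
      rw [hXX'] at hx'
      simpa using hx' 1 h1Λ'
    · have : m * x ∈ X' * Λ' := Submodule.mul_mem_mul hm hx
      rwa [hX'Λ'] at this
  have hLX' : leftOrder X' = rightOrder I := by
    refine le_antisymm (fun x hx => ?_) fun x hx m hm => ?_
    · have hx' : x ∈ leftOrder (X' * X) := Brandt.leftOrder_le_leftOrder_mul X' X hx
      rw [hX'X] at hx'
      simpa using hx' 1 (one_mem_rightOrder I)
    · have hxm : x * m ∈ rightOrder I * (I' * B) := Submodule.mul_mem_mul hx hm
      rw [← mul_assoc, hOI'] at hxm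
      exact hxm
  -- fullness
  have hXfull : IsFullLattice D X := by
    refine ⟨(fg_embLattice ψ Jf).mul hIfull.1, fun d => ?_⟩
    obtain ⟨n, hn, hnd⟩ := hIfull.2 d
    have hm : Ideal.absNorm J ≠ 0 := fun h0 => hJ (Ideal.absNorm_eq_zero_iff.mp h0)
    have hmA : ((Ideal.absNorm J : ℕ) : D) ∈ A := by
      have hmem : algebraMap (𝓞 K) K ((Ideal.absNorm J : ℕ) : 𝓞 K) ∈ (Jf : Submodule (𝓞 K) K) :=
        FractionalIdeal.mem_coe.mpr
          (FractionalIdeal.mem_coeIdeal_of_mem (S := (𝓞 K)⁰) (P := K) (Ideal.absNorm_mem J))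
      simpa using map_mem_embLattice (ψ := ψ) hmem
    refine ⟨(Ideal.absNorm J : ℤ) * n, mul_ne_zero (Int.natCast_ne_zero.mpr hm) hn, ?_⟩
    rw [mul_smul, zsmul_eq_mul, Int.cast_natCast]
    exact Submodule.mul_mem_mul hmA hnd
  have h1B : (1 : D) ∈ B := by
    have h10 : (1 : FractionalIdeal (𝓞 K)⁰ K) ≠ 0 := one_ne_zero
    have h1le : (1 : FractionalIdeal (𝓞 K)⁰ K) ≤ Jf⁻¹ :=
      (FractionalIdeal.le_inv_comm h10 hJf).mpr (by
        rw [inv_one]; exact FractionalIdeal.coeIdeal_le_one)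
    have h1 : (1 : K) ∈ ((Jf⁻¹ : FractionalIdeal (𝓞 K)⁰ K) : Submodule (𝓞 K) K) := by
      have := FractionalIdeal.coe_le_coe.mpr h1le
      rw [FractionalIdeal.coe_one] at this
      exact Submodule.one_le.mp this
    simpa using map_mem_embLattice (ψ := ψ) h1
  have hX'full : IsFullLattice D X' := by
    refine ⟨hI'full.1.mul (fg_embLattice ψ Jf⁻¹), fun d => ?_⟩
    obtain ⟨n, hn, hnd⟩ := hI'full.2 d
    refine ⟨n, hn, ?_⟩
    rw [← mul_one (n • d)]
    exact Submodule.mul_mem_mul hnd h1B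
  -- assemble
  refine ⟨⟨hXfull, hRX.trans hIright, X', hX'full, hXX'.trans hLX.symm, hLX.trans hRX'.symm,
    hX'X.trans hRX.symm, hLX'.trans hRX.symm⟩, fun x => ?_, fun k hk => ?_⟩
  · rw [hLX]
    exact hEΛ'le (map_mem_embLattice (Submodule.mem_one.mpr ⟨x, rfl⟩))
  · rw [hLX] at hk
    refine hopt k ?_
    have h1BA : (1 : D) ∈ B * A := by rw [hBA]; exact h1E
    suffices hsuff : ∀ r ∈ B * A, ψ k * r ∈ Λ by simpa using hsuff 1 h1BA
    intro r hr
    refine Submodule.mul_induction_on hr (fun b hb a ha => ?_) fun y z hy hz => ?_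
    · rw [← mul_assoc, map_mul_comm_of_mem_embLattice hb k, ← hBΛ'A]
      exact Submodule.mul_mem_mul (Submodule.mul_mem_mul hb hk) ha
    · rw [mul_add]
      exact add_mem hy hz

/-- For a Gross point `(ψ, I)` and `J ≠ 0`, **`ψ(J) I` is an invertible right `O`-ideal**. [folklore] -/
theorem IsGrossPoint.grossTranslate_mem_rightIdeals (h : IsGrossPoint O ψ I) {J : Ideal (𝓞 K)}
    (hJ : J ≠ ⊥) : grossTranslate ψ J I ∈ rightIdeals O :=
  (h.translate hJ).mem_rightIdeals

/-- **The `Pic(𝓞_K)`-action on classes of Gross points**: `[𝔞] · [(ψ, I)] = [ψ(𝔞) I] ∈ Cls O`,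
computed on the integral representative `idealRep 𝔞` (independent of it: `act_eq_mk`). This is the
(free) action of `Pic(𝓞_K)` on the special points of Gross 1987 §3, Vatsal 2004 §7.1. [cite: Gross1987, §3] -/
def IsGrossPoint.act (h : IsGrossPoint O ψ I) (𝔞 : ClassGroup (𝓞 K)) : ClassSet O :=
  Quotient.mk (rightClassSetoid O)
    ⟨grossTranslate ψ (idealRep 𝔞) I,
      h.grossTranslate_mem_rightIdeals (ne_bot_of_mem_nonZeroDivisors (idealRep 𝔞))⟩

/-- **Independence of the representative**: for any non-zero ideal `J` in the class `𝔞`,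
`[𝔞] · [(ψ, I)] = [ψ(J) I]`. [folklore] -/
theorem IsGrossPoint.act_eq_mk (h : IsGrossPoint O ψ I) {J : (Ideal (𝓞 K))⁰} {𝔞 : ClassGroup (𝓞 K)}
    (hJ : ClassGroup.mk0 J = 𝔞) :
    h.act 𝔞 = Quotient.mk (rightClassSetoid O)
      ⟨grossTranslate ψ J I, h.grossTranslate_mem_rightIdeals (ne_bot_of_mem_nonZeroDivisors J)⟩ := by
  obtain ⟨α, hα⟩ := exists_grossTranslate_eq_smul ((mk0_idealRep 𝔞).trans hJ.symm) ψ I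
  exact Quotient.sound ⟨α, hα⟩

/-- The action in the unbundled form used by route `ToricShedding`: the chosen representative
ideal `(h.act 𝔞).rep` of the class `[𝔞] · [(ψ, I)]` is `α · ψ(J) I` for an integral ideal `J` of
class `𝔞` and a unit `α ∈ Dˣ`. [folklore] -/
theorem IsGrossPoint.exists_rep_act (h : IsGrossPoint O ψ I) (𝔞 : ClassGroup (𝓞 K)) :
    ∃ (J : (Ideal (𝓞 K))⁰) (α : Dˣ), ClassGroup.mk0 J = 𝔞 ∧
      ∀ x : D, x ∈ (h.act 𝔞).rep ↔
        ∃ y ∈ Submodule.span ℤ ((fun x : 𝓞 K => ψ (x : K)) '' ((J : Ideal (𝓞 K)) : Set (𝓞 K))) * I,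
          x = (α : D) * y := by
  letI := rightClassSetoid O
  set XI : rightIdeals O := ⟨grossTranslate ψ (idealRep 𝔞) I,
    h.grossTranslate_mem_rightIdeals (ne_bot_of_mem_nonZeroDivisors (idealRep 𝔞))⟩ with hXI
  have hrel : (Quotient.mk _ XI : ClassSet O).out ≈ XI := Quotient.mk_out XI
  obtain ⟨α, hα⟩ := hrel
  refine ⟨idealRep 𝔞, α⁻¹, mk0_idealRep 𝔞, fun x => ?_⟩
  have hrep : (h.act 𝔞).rep = α⁻¹ • grossTranslate ψ (idealRep 𝔞) I := by
    rw [eq_inv_smul_iff]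
    exact hα.symm
  rw [hrep, mem_units_smul_submodule_iff, inv_inv]
  constructor
  · intro hx
    exact ⟨_, hx, by rw [Units.smul_def, smul_eq_mul, Units.inv_mul_cancel_left]⟩
  · rintro ⟨y, hy, rfl⟩
    rw [Units.smul_def, smul_eq_mul, Units.mul_inv_cancel_left]
    exact hy

end GrossPoints

/-! ### Toric periods -/

section Eval

variable {D : Type u} [Ring D]

/-- The value of a function `φ` on the class set `Cls O` at a lattice `X ⊆ D`: `φ [X]` if `X` is an
invertible right `O`-ideal, and the junk value `0` otherwise. [folklore] -/
def evalAtLattice {R : Type*} [Zero R] {O : Submodule ℤ D} (φ : ClassSet O → R)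
    (X : Submodule ℤ D) : R :=
  open scoped Classical in
  if hX : X ∈ rightIdeals O then φ (Quotient.mk (rightClassSetoid O) ⟨X, hX⟩) else 0

/-- `evalAtLattice φ X = φ [X]` for an invertible right `O`-ideal `X`. [folklore] -/
theorem evalAtLattice_of_mem {R : Type*} [Zero R] {O : Submodule ℤ D} (φ : ClassSet O → R)
    {X : Submodule ℤ D} (hX : X ∈ rightIdeals O) :
    evalAtLattice φ X = φ (Quotient.mk (rightClassSetoid O) ⟨X, hX⟩) := by
  rw [evalAtLattice, dif_pos hX]

/-- `evalAtLattice φ X = 0` off the invertible right `O`-ideals. [folklore] -/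
theorem evalAtLattice_of_not_mem {R : Type*} [Zero R] {O : Submodule ℤ D} (φ : ClassSet O → R)
    {X : Submodule ℤ D} (hX : X ∉ rightIdeals O) : evalAtLattice φ X = 0 := by
  rw [evalAtLattice, dif_neg hX]

end Eval

section ToricPeriods

variable {D : Type u} [Ring D] [Algebra ℚ D]
variable {K : Type*} [Field K] [NumberField K]

/-- The **toric period** (Gross period) of `φ : Cls O → R` at the pair `(ψ, I)`:
`Σ_{[𝔞] ∈ Cl(K)} φ([ψ(𝔞) I])`, the value of `φ` on the `Pic(𝓞_K)`-orbit of the Gross point `(ψ, I)`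
— Gross's `Σ_{σ ∈ Pic(𝓞_K)} φ(P^σ)` (Vatsal 2004 (7-5) and Theorem 6.4 with the trivial character:
for a Hecke eigenvector `φ` attached to `f`, it is non-zero iff `L(f/K, 1) ≠ 0`, by Gross's special
value formula / Waldspurger).  Each class `𝔞` contributes through its integral representative
`idealRep 𝔞` and `evalAtLattice` (junk `0` at a lattice that is not an invertible right `O`-ideal,
which does not happen at a Gross point: `IsGrossPoint.toricPeriod_eq`).  For a Brandt set-up `S`:
`toricPeriod S.O ψ I φ`. [cite: Vatsal2004, Theorem 6.4 and (7-5)] -/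
def toricPeriod {R : Type*} [AddCommMonoid R] (O : Submodule ℤ D) (ψ : K →ₐ[ℚ] D)
    (I : Submodule ℤ D) (φ : ClassSet O → R) : R :=
  ∑ 𝔞 : ClassGroup (𝓞 K), evalAtLattice φ (grossTranslate ψ (idealRep 𝔞) I)

/-- `toricPeriod` unfolded. [folklore] -/
theorem toricPeriod_def {R : Type*} [AddCommMonoid R] (O : Submodule ℤ D) (ψ : K →ₐ[ℚ] D)
    (I : Submodule ℤ D) (φ : ClassSet O → R) :
    toricPeriod O ψ I φ =
      ∑ 𝔞 : ClassGroup (𝓞 K), evalAtLattice φ (grossTranslate ψ (idealRep 𝔞) I) :=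
  rfl

/-- **The toric period of a Gross point is the sum of `φ` over its `Pic(𝓞_K)`-orbit**:
`toricPeriod O ψ I φ = Σ_𝔞 φ ([𝔞] · [(ψ, I)])`. [cite: Vatsal2004, Theorem 6.4 and (7-5)] -/
theorem IsGrossPoint.toricPeriod_eq {R : Type*} [AddCommMonoid R] {O I : Submodule ℤ D}
    {ψ : K →ₐ[ℚ] D} (h : IsGrossPoint O ψ I) (φ : ClassSet O → R) :
    toricPeriod O ψ I φ = ∑ 𝔞 : ClassGroup (𝓞 K), φ (h.act 𝔞) := by
  refine Finset.sum_congr rfl fun 𝔞 _ => ?_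
  rw [evalAtLattice_of_mem φ
    (h.grossTranslate_mem_rightIdeals (ne_bot_of_mem_nonZeroDivisors (idealRep 𝔞)))]
  rfl

/-- The toric period is additive in `φ`. [folklore] -/
theorem toricPeriod_add {R : Type*} [AddCommMonoid R] (O : Submodule ℤ D) (ψ : K →ₐ[ℚ] D)
    (I : Submodule ℤ D) (φ φ' : ClassSet O → R) :
    toricPeriod O ψ I (φ + φ') = toricPeriod O ψ I φ + toricPeriod O ψ I φ' := by
  rw [toricPeriod, toricPeriod, toricPeriod, ← Finset.sum_add_distrib]
  refine Finset.sum_congr rfl fun 𝔞 _ => ?_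
  by_cases hX : grossTranslate ψ (idealRep 𝔞) I ∈ rightIdeals O
  · rw [evalAtLattice_of_mem _ hX, evalAtLattice_of_mem _ hX, evalAtLattice_of_mem _ hX,
      Pi.add_apply]
  · rw [evalAtLattice_of_not_mem _ hX, evalAtLattice_of_not_mem _ hX,
      evalAtLattice_of_not_mem _ hX, add_zero]

end ToricPeriods

end Brandt

end Literature.NumberTheory.Automorphic
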